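import Literature.MathematicalPhysics.QuantumLattice.KomaPiFluxCoulombPrintedLongRangeOrder
import Literature.MathematicalPhysics.QuantumLattice.DWaveKomaTasakiSystem
import Literature.MathematicalPhysics.QuantumLattice.FermionQuasiFree
import HarnessLib

/-!
# Koma's `π`-flux BCS lattice-fermion model IS a Koma–Tasaki `U(1)` system
# (the instance behind Koma 2022 eq. (2.15): "there appears a spontaneous magnetization")

T. Koma, *Nambu–Goldstone modes for superconducting lattice fermions*, arXiv:2201.13135 (2022)
[Koma2022], §2, after (2.14): "For the parameters `κ, g, g'` in the parameter region of Theorem 2.1, this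
is the symmetry-breaking infinite-volume ground state. Actually, there appears a spontaneous magnetization
in the sense that [33] `|Λ|⁻¹ ω_{0,g'}(O^{(Λ)}) ≥ μ > 0` (2.15) for a large `Λ`, where `μ` is a positive
constant."  Reference [33] is T. Koma, H. Tasaki, *Symmetry breaking in Heisenberg antiferromagnets*,
Commun. Math. Phys. 158 (1993) 191 [KomaTasaki1993], whose Theorem 7.3 ("long-range order of the symmetric
ground states ⟹ order `≥ √2 σ` of every ground state under a symmetry-breaking field", `U(1)` case,
"the electron pair condensation problems in lattice electron systems", p. 211) is PROVED in the tree for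
the abstract Koma–Tasaki `U(1)` systems of [KomaTasaki1994] §2.3
(`KomaTasaki.komaTasakiU1Field_u1`, file `KomaTasakiU1FieldBound.lean`).

This file supplies the INSTANCE: Koma's model in Lieb's frame (`KomaPiFlux.hamiltonianC κ U g g' 0 0` of
`KomaPiFluxCoulombGaussianDomination.lean`: `π`-flux hopping `κ`, on-site `U`, BCS pair hopping `g`,
nearest-neighbour Coulomb repulsion `g'`, on the torus `(ℤ/Lℤ)^{d+1}`) together with the on-site pair
densities `o^{(1)}_x = Γ²_x`, `o^{(2)}_x = Γ¹_x` ((3.3); so that `O^{(1)} = Σ_x Γ²_x = orderParameter` is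
exactly the operator sourced by `B` in `hamiltonianC κ U g g' 0 B = H - B·O^{(1)}`) and the charge
`C = N/2` is a `KomaTasaki.U1System` — hypotheses (2.12)–(2.17) i)–iii) of [KomaTasaki1994] §2.3 ALL
PROVED:

* `KomaPiFlux.KT.localHam κ U g g' x` — the terms of `H` anchored at the site `x` (symmetrised hoppings
  on the bonds out of `x`, `U(n_{x↑}-½)(n_{x↓}-½)`, the pair bonds `(g/8){[Γ¹_x-Γ¹_y]²+[Γ²_x-Γ²_y]²}` and
  the Coulomb bonds `(g'/2)Γ³_xΓ³_y` out of `x`); `Σ_x localHam x = hamiltonianC κ U g g' 0 0`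
  (`sum_localHam`); Hermitian; an even operator localised on the closed neighbourhood `nbhd x`
  (`|nbhd x| ≤ 2(d+1)+1`); `‖localHam x‖ ≤ hbarConst d κ U g g'` uniformly in `L`;
* `KomaPiFlux.KT.orderDensity α x` — `Γ²_x` (`α = 0`), `Γ¹_x` (`α = 1`): Hermitian, even, on-site, norm `≤ 2`;
  `Σ_x o^{(1)}_x = orderParameter`, and the charge relations (2.14)
  `[Σ_xΓ²_x, N/2] = -iΣ_xΓ¹_x`, `[Σ_xΓ¹_x, N/2] = iΣ_xΓ²_x` from `[N, Γ^±_x] = ±2Γ^±_x`;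
* `PairHopRP.commute_totalNumber_hamiltonianC_zero` — `H` (no DLS field, no source) conserves `N` (2.12);
* **`KomaPiFlux.ktSystem κ U g g' : KomaTasaki.U1System (FermionTorus (d+1) L) (EuclideanSpace ℂ _)`**
  (transport along `Matrix.toEuclideanCLM`), with `r = 2(d+1)+1`, `o = 2`, `h̄ = hbarConst d κ U g g'`;
* dictionary: `ktSystem_hamiltonian`, `ktSystem_order_zero/one`, `ktSystem_C`, `ktSystem_field`
  (`H_sys - B·O^{(1)}_sys = toEuclideanCLM (hamiltonianC κ U g g' 0 B)`), `ktSystem_obar/hbar/r`;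
* `KomaPiFlux.ktSystem_isLROEigenstate` — hypothesis iv) (2.17) from matrix data: a unit eigenvector `Φ` of
  `H` and of `N` with `(2μ'|Λ|)² ≤ Re Φ†(Σ_xΓ¹_x)²Φ` is an `IsLROEigenstate` with parameter `μ'` (the
  companion value for `Σ_xΓ²_x` is automatic, `KomaTasaki.U1System.inner_order_sq_eq_of_eigen_C`);
* ground states in matrix terms for a general index type (`Matrix.groundEnergy_le_re_inner_toEuclideanCLM'`,
  `Matrix.re_inner_toEuclideanCLM_le_of_groundState`) — the hypotheses `hground`/`hmin` of the field theorems.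

With this instance KT93 Theorem 7.3 applies to Koma's model BY NAME; the assembly with the long-range
order of Theorem 2.1 (`KomaPiFlux.groundState_superconductingOrder_coulomb`) — i.e. (2.15) — is the
companion file `KomaPiFluxSpontaneousOrder.lean`.  No named facts; every statement is proved.

## References

* [Koma2022] T. Koma, arXiv:2201.13135, (2.4)–(2.6), (2.12)–(2.15), (3.1)–(3.3), (3.8)–(3.10), (8.1).
* [KomaTasaki1994] T. Koma, H. Tasaki, J. Stat. Phys. 76 (1994) 745–803, §2.3 (2.12)–(2.17), §3.3–3.4.
* [KomaTasaki1993] T. Koma, H. Tasaki, Commun. Math. Phys. 158 (1993) 191–214, §7, Theorem 7.3.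
* [Tasaki2020] H. Tasaki, *Physics and Mathematics of Quantum Many-Body Systems*, Springer 2020, §2.1, App. A.

## Design notes

* The template is `DWaveKomaTasakiSystem.lean` (the Hubbard `d`-wave instance); here the order densities
  are ON-SITE and commute at different sites exactly, so the plain `U1System` (hypothesis i)) is used.
* `attribute [local instance] LiebCutRP.decEqTorus`, as in every file of the `KomaPiFlux` series, so that
  the statements elaborate with the series' `DecidableEq` instance on the torus.
-/

noncomputable section

namespace Literature.MathematicalPhysics.QuantumLattice

open _root_.Matrix Finset Filter Topology HubbardWave0 PairHopRP FermionTorus LiebCutRP WithLp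
open Literature.Probability.LatticeModels
open scoped Matrix.Norms.L2Operator InnerProductSpace ComplexConjugate ComplexOrder

/-! ### Generic lattice: charge bookkeeping, norms and supports of the `Γ` operators -/

namespace PairHopRP

section Generic

variable {Λ : Type*} [LinearOrder Λ] [Fintype Λ]

/-- `[N, c†_p] = c†_p`. [cite: Tasaki2020, §9.2 (the number operator)] -/
theorem totalNumber_commutator_creation (p : Orb Λ) :
    totalNumber * creation p - creation p * totalNumber = (creation p : Matrix (Finset (Orb Λ)) (Finset (Orb Λ)) ℂ) := by
  rw [← totalNumberOp_eq_totalNumber]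
  simp only [totalNumberOp, numberAt, Finset.sum_mul, Finset.mul_sum, ← Finset.sum_sub_distrib,
    creation_mul_annihilation_commutator_creation, Finset.sum_ite_eq', Finset.mem_univ, if_true]

/-- `[N, c_p] = -c_p`. [cite: Tasaki2020, §9.2] -/
theorem totalNumber_commutator_annihilation (p : Orb Λ) :
    totalNumber * annihilation p - annihilation p * totalNumber = -(annihilation p : Matrix (Finset (Orb Λ)) (Finset (Orb Λ)) ℂ) := by
  rw [← totalNumberOp_eq_totalNumber]
  simp only [totalNumberOp, numberAt, Finset.sum_mul, Finset.mul_sum, ← Finset.sum_sub_distrib,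
    creation_mul_annihilation_commutator_annihilation, Finset.sum_ite_eq', Finset.mem_univ, if_true]

/-- If `[N, A] = aA` and `[N, B] = -aB` then `N` commutes with `AB`. [folklore] -/
private theorem commute_mul_of_commutators {k : Type*} [Fintype k] {N A B : Matrix k k ℂ} {a : ℂ}
    (hA : N * A - A * N = a • A) (hB : N * B - B * N = -(a • B)) : Commute N (A * B) := by
  rw [sub_eq_iff_eq_add] at hA hB
  rw [Commute, SemiconjBy, ← Matrix.mul_assoc, hA, Matrix.add_mul, Matrix.smul_mul, Matrix.mul_assoc, hB,
    Matrix.mul_add, Matrix.mul_neg, Matrix.mul_smul, Matrix.mul_assoc]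
  abel

/-- `N` commutes with every hopping `c†_p c_q`. [cite: Tasaki2020, §9.2] -/
theorem commute_totalNumber_creation_mul_annihilation (p q : Orb Λ) :
    Commute (totalNumber : Matrix (Finset (Orb Λ)) (Finset (Orb Λ)) ℂ) (creation p * annihilation q) := by
  refine commute_mul_of_commutators (a := 1) ?_ ?_
  · rw [one_smul]; exact totalNumber_commutator_creation p
  · rw [one_smul]; exact totalNumber_commutator_annihilation q

/-- `N` commutes with `n_{xσ}`. [cite: Tasaki2020, §9.2] -/
theorem commute_totalNumber_numberOp (x : Λ) (σ : Fin 2) :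
    Commute (totalNumber : Matrix (Finset (Orb Λ)) (Finset (Orb Λ)) ℂ) (numberOp x σ) :=
  commute_totalNumber_creation_mul_annihilation _ _

/-- `[N, Γ⁺_x] = 2Γ⁺_x`. [cite: Koma2022, (3.8)–(3.10)] -/
theorem totalNumber_commutator_gammaPlus (x : Λ) :
    totalNumber * gammaPlus x - gammaPlus x * totalNumber = (2 : ℂ) • gammaPlus x := by
  unfold gammaPlus
  exact totalNumber_commutator_pairCreation _ _

/-- `[N, Γ⁻_x] = -2Γ⁻_x`. [cite: Koma2022, (3.8)–(3.10)] -/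
theorem totalNumber_commutator_gammaMinus (x : Λ) :
    totalNumber * gammaMinus x - gammaMinus x * totalNumber = -((2 : ℂ) • gammaMinus x) := by
  unfold gammaMinus
  rw [totalNumber_commutator_annihilation_mul_annihilation, neg_smul]

/-- `N` commutes with `Γ⁺_xΓ⁻_y`. [cite: Koma2022, (3.8)–(3.10)] -/
theorem commute_totalNumber_gammaPlus_mul_gammaMinus (x y : Λ) :
    Commute (totalNumber : Matrix (Finset (Orb Λ)) (Finset (Orb Λ)) ℂ) (gammaPlus x * gammaMinus y) :=
  commute_mul_of_commutators (totalNumber_commutator_gammaPlus x) (totalNumber_commutator_gammaMinus y)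

/-- `N` commutes with `Γ⁻_xΓ⁺_y`. [cite: Koma2022, (3.8)–(3.10)] -/
theorem commute_totalNumber_gammaMinus_mul_gammaPlus (x y : Λ) :
    Commute (totalNumber : Matrix (Finset (Orb Λ)) (Finset (Orb Λ)) ℂ) (gammaMinus x * gammaPlus y) := by
  refine commute_mul_of_commutators (a := -2) ?_ ?_
  · rw [totalNumber_commutator_gammaMinus, neg_smul]
  · rw [totalNumber_commutator_gammaPlus, neg_smul, neg_neg]

/-- `N` commutes with `Γ³_x`. [cite: Koma2022, (3.9)] -/
theorem commute_totalNumber_gammaThree (x : Λ) :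
    Commute (totalNumber : Matrix (Finset (Orb Λ)) (Finset (Orb Λ)) ℂ) (gammaThree x) := by
  unfold gammaThree
  exact ((Commute.one_right _).sub_right (commute_totalNumber_numberOp x 0)).sub_right
    (commute_totalNumber_numberOp x 1)

/-- The squares of the pair bond: `[Γ¹_x-Γ¹_y]² + [Γ²_x-Γ²_y]² = 2{Γ⁺_xΓ⁻_x + Γ⁻_xΓ⁺_x} + 2{Γ⁺_yΓ⁻_y + Γ⁻_yΓ⁺_y}
- 2{Γ⁺_xΓ⁻_y + Γ⁻_xΓ⁺_y} - 2{Γ⁺_yΓ⁻_x + Γ⁻_yΓ⁺_x}` ((3.4), (3.7)). [cite: Koma2022, (3.4), (3.7)] -/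
theorem bondSquares_eq (x y : Λ) :
    (gammaOne x - gammaOne y) * (gammaOne x - gammaOne y) + (gammaTwo x - gammaTwo y) * (gammaTwo x - gammaTwo y) =
      (2 : ℂ) • (gammaPlus x * gammaMinus x + gammaMinus x * gammaPlus x) +
        (2 : ℂ) • (gammaPlus y * gammaMinus y + gammaMinus y * gammaPlus y) -
        (2 : ℂ) • (gammaPlus x * gammaMinus y + gammaMinus x * gammaPlus y) -
        (2 : ℂ) • (gammaPlus y * gammaMinus x + gammaMinus y * gammaPlus x) := by
  have h1 := gammaOne_mul_gammaOne_add x y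
  have h2 := gammaOne_mul_gammaOne_add y x
  have h3 := gammaOne_mul_self x
  have h4 := gammaTwo_mul_self x
  have h5 := gammaOne_mul_self y
  have h6 := gammaTwo_mul_self y
  calc (gammaOne x - gammaOne y) * (gammaOne x - gammaOne y) + (gammaTwo x - gammaTwo y) * (gammaTwo x - gammaTwo y)
      = (gammaOne x * gammaOne x + gammaTwo x * gammaTwo x) + (gammaOne y * gammaOne y + gammaTwo y * gammaTwo y) -
          (gammaOne x * gammaOne y + gammaTwo x * gammaTwo y) - (gammaOne y * gammaOne x + gammaTwo y * gammaTwo x) := by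
        noncomm_ring
    _ = _ := by rw [h1, h2, h3, h4, h5, h6, ← two_smul ℂ, ← two_smul ℂ]

/-- `N` commutes with the pair bond at zero DLS field. [cite: Koma2022, (3.4)–(3.5)] -/
theorem commute_totalNumber_bondTerm_zero (g : ℝ) (x y : Λ) :
    Commute (totalNumber : Matrix (Finset (Orb Λ)) (Finset (Orb Λ)) ℂ) (bondTerm g 0 x y) := by
  rw [bondTerm, Complex.ofReal_zero, zero_smul, add_zero, bondSquares_eq]
  refine Commute.smul_right ?_ _
  refine Commute.sub_right (Commute.sub_right (Commute.add_right ?_ ?_) ?_) ?_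
  · exact ((commute_totalNumber_gammaPlus_mul_gammaMinus x x).add_right
      (commute_totalNumber_gammaMinus_mul_gammaPlus x x)).smul_right _
  · exact ((commute_totalNumber_gammaPlus_mul_gammaMinus y y).add_right
      (commute_totalNumber_gammaMinus_mul_gammaPlus y y)).smul_right _
  · exact ((commute_totalNumber_gammaPlus_mul_gammaMinus x y).add_right
      (commute_totalNumber_gammaMinus_mul_gammaPlus x y)).smul_right _
  · exact ((commute_totalNumber_gammaPlus_mul_gammaMinus y x).add_right
      (commute_totalNumber_gammaMinus_mul_gammaPlus y x)).smul_right _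

variable (G : SimpleGraph Λ) [DecidableRel G.Adj]

/-- `N` commutes with the Peierls–Hubbard Hamiltonian (hoppings and densities). [cite: Koma2022, (2.4)] [cite: Tasaki2020, §9.2] -/
theorem commute_totalNumber_peierlsHubbard (T : Fin 2 → Λ → Λ → ℂ) (U : ℝ) :
    Commute (totalNumber : Matrix (Finset (Orb Λ)) (Finset (Orb Λ)) ℂ) (peierlsHubbard G T U) := by
  rw [peierlsHubbard]
  refine Commute.add_right (Commute.neg_right (Commute.sum_right _ _ _ fun x _ =>
    Commute.sum_right _ _ _ fun y _ => Commute.sum_right _ _ _ fun σ _ => ?_)) (Commute.smul_right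
      (Commute.sum_right _ _ _ fun x _ => ?_) _)
  · split_ifs
    · exact (commute_totalNumber_creation_mul_annihilation _ _).smul_right _
    · exact Commute.zero_right _
  · exact ((commute_totalNumber_numberOp x 0).sub_right ((Commute.one_right _).smul_right _)).mul_right
      ((commute_totalNumber_numberOp x 1).sub_right ((Commute.one_right _).smul_right _))

/-- `N` commutes with the pair interaction at zero DLS field. [cite: Koma2022, (3.2)–(3.5)] -/
theorem commute_totalNumber_pairInteraction_zero (g : ℝ) :
    Commute (totalNumber : Matrix (Finset (Orb Λ)) (Finset (Orb Λ)) ℂ) (pairInteraction G g fun _ _ => 0) := by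
  rw [pairInteraction]
  refine Commute.sum_right _ _ _ fun x _ => Commute.sum_right _ _ _ fun y _ => ?_
  split_ifs
  · exact commute_totalNumber_bondTerm_zero g x y
  · exact Commute.zero_right _

/-- `N` commutes with the Coulomb repulsion. [cite: Koma2022, (8.1)] -/
theorem commute_totalNumber_coulomb (g' : ℝ) :
    Commute (totalNumber : Matrix (Finset (Orb Λ)) (Finset (Orb Λ)) ℂ) (coulomb G g') := by
  rw [coulomb]
  refine Commute.sum_right _ _ _ fun x _ => Commute.sum_right _ _ _ fun y _ => ?_
  split_ifs
  · rw [coulombBond]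
    exact ((commute_totalNumber_gammaThree x).mul_right (commute_totalNumber_gammaThree y)).smul_right _
  · exact Commute.zero_right _

/-- **(2.12) for Koma's model**: without DLS field and source, `H(T,U;g,g';0;0)` conserves the particle
number. [cite: Koma2022, (2.4), (2.12)–(2.13)] [cite: KomaTasaki1994, (2.12)] -/
theorem commute_totalNumber_hamiltonianC_zero (T : Fin 2 → Λ → Λ → ℂ) (U g g' : ℝ) :
    Commute (totalNumber : Matrix (Finset (Orb Λ)) (Finset (Orb Λ)) ℂ) (hamiltonianC G T U g g' (fun _ _ => 0) 0) := by
  rw [hamiltonianC, hamiltonian, Complex.ofReal_zero, zero_smul, sub_zero]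
  exact ((commute_totalNumber_peierlsHubbard G T U).add_right (commute_totalNumber_pairInteraction_zero G g)).add_right
    (commute_totalNumber_coulomb G g')

/-! #### The charge relations (2.14) -/

/-- `Γ²_x (N/2) - (N/2) Γ²_x = -iΓ¹_x`. [cite: Koma2022, (3.8)–(3.10)] [cite: KomaTasaki1994, (2.14)] -/
theorem gammaTwo_comm_halfNumber (x : Λ) :
    gammaTwo x * ((2 : ℂ)⁻¹ • totalNumber) - ((2 : ℂ)⁻¹ • totalNumber) * gammaTwo x = -(Complex.I • gammaOne x) := by
  have hp := totalNumber_commutator_gammaPlus x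
  have hm := totalNumber_commutator_gammaMinus x
  rw [sub_eq_iff_eq_add] at hp hm
  rw [Matrix.mul_smul, Matrix.smul_mul, gammaTwo, gammaOne, Matrix.smul_mul, Matrix.mul_smul, Matrix.sub_mul,
    Matrix.mul_sub, hp, hm]
  module

/-- `Γ¹_x (N/2) - (N/2) Γ¹_x = iΓ²_x`. [cite: Koma2022, (3.8)–(3.10)] [cite: KomaTasaki1994, (2.14)] -/
theorem gammaOne_comm_halfNumber (x : Λ) :
    gammaOne x * ((2 : ℂ)⁻¹ • totalNumber) - ((2 : ℂ)⁻¹ • totalNumber) * gammaOne x = Complex.I • gammaTwo x := by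
  have hp := totalNumber_commutator_gammaPlus x
  have hm := totalNumber_commutator_gammaMinus x
  rw [sub_eq_iff_eq_add] at hp hm
  rw [gammaTwo, smul_smul, Complex.I_mul_I, Matrix.mul_smul, Matrix.smul_mul, gammaOne, Matrix.add_mul,
    Matrix.mul_add, hp, hm]
  module

/-! #### Norms -/

/-- `‖Γ⁺_x‖ ≤ 1`. [cite: Koma2022, (3.1)] -/
theorem norm_gammaPlus_le (x : Λ) : ‖(gammaPlus x : Matrix (Finset (Orb Λ)) (Finset (Orb Λ)) ℂ)‖ ≤ 1 :=
  (norm_mul_le _ _).trans (mul_le_one₀ (norm_creation_le_one _) (norm_nonneg _) (norm_creation_le_one _))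

/-- `‖Γ⁻_x‖ ≤ 1`. [cite: Koma2022, (3.1)] -/
theorem norm_gammaMinus_le (x : Λ) : ‖(gammaMinus x : Matrix (Finset (Orb Λ)) (Finset (Orb Λ)) ℂ)‖ ≤ 1 :=
  (norm_mul_le _ _).trans (mul_le_one₀ (norm_annihilation_le_one _) (norm_nonneg _) (norm_annihilation_le_one _))

/-- `‖Γ¹_x‖ ≤ 2`. [cite: Koma2022, (3.3)] -/
theorem norm_gammaOne_le (x : Λ) : ‖(gammaOne x : Matrix (Finset (Orb Λ)) (Finset (Orb Λ)) ℂ)‖ ≤ 2 :=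
  (norm_add_le _ _).trans (by linarith [norm_gammaPlus_le x, norm_gammaMinus_le x])

/-- `‖Γ²_x‖ ≤ 2`. [cite: Koma2022, (3.3)] -/
theorem norm_gammaTwo_le (x : Λ) : ‖(gammaTwo x : Matrix (Finset (Orb Λ)) (Finset (Orb Λ)) ℂ)‖ ≤ 2 := by
  rw [gammaTwo, norm_smul, Complex.norm_I, one_mul]
  exact (norm_sub_le _ _).trans (by linarith [norm_gammaPlus_le x, norm_gammaMinus_le x])

/-- `‖Γ³_x‖ ≤ 3`. [cite: Koma2022, (3.9)] -/
theorem norm_gammaThree_le (x : Λ) : ‖(gammaThree x : Matrix (Finset (Orb Λ)) (Finset (Orb Λ)) ℂ)‖ ≤ 3 := by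
  rw [gammaThree]
  calc _ ≤ ‖(1 : Matrix (Finset (Orb Λ)) (Finset (Orb Λ)) ℂ) - numberOp x 0‖ + ‖(numberOp x 1 : Matrix (Finset (Orb Λ)) (Finset (Orb Λ)) ℂ)‖ :=
        norm_sub_le _ _
    _ ≤ (‖(1 : Matrix (Finset (Orb Λ)) (Finset (Orb Λ)) ℂ)‖ + ‖(numberOp x 0 : Matrix (Finset (Orb Λ)) (Finset (Orb Λ)) ℂ)‖) + 1 :=
        add_le_add (norm_sub_le _ _) (norm_numberOp_le_one x 1)
    _ ≤ (1 + 1) + 1 := by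
        gcongr
        · exact norm_one.le
        · exact norm_numberOp_le_one x 0
    _ = 3 := by norm_num

/-- `‖(g/8){[Γ¹_x-Γ¹_y]²+[Γ²_x-Γ²_y]²}‖ ≤ 4|g|`. [cite: Koma2022, (3.5)] -/
theorem norm_bondTerm_zero_le (g : ℝ) (x y : Λ) :
    ‖(bondTerm g 0 x y : Matrix (Finset (Orb Λ)) (Finset (Orb Λ)) ℂ)‖ ≤ 4 * |g| := by
  rw [bondTerm, Complex.ofReal_zero, zero_smul, add_zero, norm_smul, Complex.norm_real, Real.norm_eq_abs,
    abs_div, abs_of_pos (by norm_num : (0:ℝ) < 8)]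
  have h1 : ‖(gammaOne x - gammaOne y : Matrix (Finset (Orb Λ)) (Finset (Orb Λ)) ℂ)‖ ≤ 4 :=
    (norm_sub_le _ _).trans (by linarith [norm_gammaOne_le x, norm_gammaOne_le y])
  have h2 : ‖(gammaTwo x - gammaTwo y : Matrix (Finset (Orb Λ)) (Finset (Orb Λ)) ℂ)‖ ≤ 4 :=
    (norm_sub_le _ _).trans (by linarith [norm_gammaTwo_le x, norm_gammaTwo_le y])
  have h3 : ‖((gammaOne x - gammaOne y) * (gammaOne x - gammaOne y) +
      (gammaTwo x - gammaTwo y) * (gammaTwo x - gammaTwo y) : Matrix (Finset (Orb Λ)) (Finset (Orb Λ)) ℂ)‖ ≤ 32 := by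
    refine (norm_add_le _ _).trans ?_
    have := norm_mul_le (gammaOne x - gammaOne y : Matrix (Finset (Orb Λ)) (Finset (Orb Λ)) ℂ) (gammaOne x - gammaOne y)
    have := norm_mul_le (gammaTwo x - gammaTwo y : Matrix (Finset (Orb Λ)) (Finset (Orb Λ)) ℂ) (gammaTwo x - gammaTwo y)
    nlinarith [norm_nonneg (gammaOne x - gammaOne y : Matrix (Finset (Orb Λ)) (Finset (Orb Λ)) ℂ),
      norm_nonneg (gammaTwo x - gammaTwo y : Matrix (Finset (Orb Λ)) (Finset (Orb Λ)) ℂ)]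
  calc |g| / 8 * _ ≤ |g| / 8 * 32 := by gcongr
    _ = 4 * |g| := by ring

/-- `‖(g'/2)Γ³_xΓ³_y‖ ≤ (9/2)|g'|`. [cite: Koma2022, (8.1)] -/
theorem norm_coulombBond_le (g' : ℝ) (x y : Λ) :
    ‖(coulombBond g' x y : Matrix (Finset (Orb Λ)) (Finset (Orb Λ)) ℂ)‖ ≤ 9 / 2 * |g'| := by
  rw [coulombBond, norm_smul, Complex.norm_real, Real.norm_eq_abs, abs_div, abs_of_pos (by norm_num : (0:ℝ) < 2)]
  have h := norm_mul_le (gammaThree x : Matrix (Finset (Orb Λ)) (Finset (Orb Λ)) ℂ) (gammaThree y)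
  have hx := norm_gammaThree_le x
  have hy := norm_gammaThree_le y
  have h9 : ‖(gammaThree x * gammaThree y : Matrix (Finset (Orb Λ)) (Finset (Orb Λ)) ℂ)‖ ≤ 9 := by
    nlinarith [norm_nonneg (gammaThree x : Matrix (Finset (Orb Λ)) (Finset (Orb Λ)) ℂ),
      norm_nonneg (gammaThree y : Matrix (Finset (Orb Λ)) (Finset (Orb Λ)) ℂ)]
  calc |g'| / 2 * _ ≤ |g'| / 2 * 9 := by gcongr
    _ = 9 / 2 * |g'| := by ring

/-! #### Supports: the `Γ` operators are even and on-site -/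

/-- `Γ⁺_x` is even and localised on any site set containing `x`. [cite: Koma2022, (3.1)] -/
theorem gammaPlus_mem {W : Finset Λ} {x : Λ} (hx : x ∈ W) :
    (gammaPlus x : Matrix (Finset (Orb Λ)) (Finset (Orb Λ)) ℂ) ∈ carEvenSubalgebra (orbSet W) :=
  Algebra.subset_adjoin ⟨(orb x 0, true), (orb x 1, true), orb_mem_orbSet hx 0, orb_mem_orbSet hx 1, rfl⟩

/-- `Γ⁻_x` is even and localised on any site set containing `x`. [cite: Koma2022, (3.1)] -/
theorem gammaMinus_mem {W : Finset Λ} {x : Λ} (hx : x ∈ W) :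
    (gammaMinus x : Matrix (Finset (Orb Λ)) (Finset (Orb Λ)) ℂ) ∈ carEvenSubalgebra (orbSet W) :=
  Algebra.subset_adjoin ⟨(orb x 1, false), (orb x 0, false), orb_mem_orbSet hx 1, orb_mem_orbSet hx 0, rfl⟩

/-- `Γ¹_x` is even and localised on any site set containing `x`. [cite: Koma2022, (3.3)] -/
theorem gammaOne_mem {W : Finset Λ} {x : Λ} (hx : x ∈ W) :
    (gammaOne x : Matrix (Finset (Orb Λ)) (Finset (Orb Λ)) ℂ) ∈ carEvenSubalgebra (orbSet W) :=
  Subalgebra.add_mem _ (gammaPlus_mem hx) (gammaMinus_mem hx)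

/-- `Γ²_x` is even and localised on any site set containing `x`. [cite: Koma2022, (3.3)] -/
theorem gammaTwo_mem {W : Finset Λ} {x : Λ} (hx : x ∈ W) :
    (gammaTwo x : Matrix (Finset (Orb Λ)) (Finset (Orb Λ)) ℂ) ∈ carEvenSubalgebra (orbSet W) :=
  Subalgebra.smul_mem _ (Subalgebra.sub_mem _ (gammaPlus_mem hx) (gammaMinus_mem hx)) _

/-- `n_{xσ}` is even and localised on any site set containing `x`. [folklore] -/
private theorem numberOp_mem {W : Finset Λ} {x : Λ} (hx : x ∈ W) (σ : Fin 2) :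
    (numberOp x σ : Matrix (Finset (Orb Λ)) (Finset (Orb Λ)) ℂ) ∈ carEvenSubalgebra (orbSet W) :=
  creation_mul_annihilation_mem_carEvenSubalgebra (orb_mem_orbSet hx σ) (orb_mem_orbSet hx σ)

/-- `Γ³_x` is even and localised on any site set containing `x`. [cite: Koma2022, (3.9)] -/
theorem gammaThree_mem {W : Finset Λ} {x : Λ} (hx : x ∈ W) :
    (gammaThree x : Matrix (Finset (Orb Λ)) (Finset (Orb Λ)) ℂ) ∈ carEvenSubalgebra (orbSet W) :=
  Subalgebra.sub_mem _ (Subalgebra.sub_mem _ (Subalgebra.one_mem _) (numberOp_mem hx 0)) (numberOp_mem hx 1)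

/-- The pair bond is even and localised on any site set containing both ends. [cite: Koma2022, (3.5)] -/
theorem bondTerm_mem {W : Finset Λ} {x y : Λ} (hx : x ∈ W) (hy : y ∈ W) (g φ : ℝ) :
    (bondTerm g φ x y : Matrix (Finset (Orb Λ)) (Finset (Orb Λ)) ℂ) ∈ carEvenSubalgebra (orbSet W) := by
  unfold bondTerm
  have hA : gammaOne x - gammaOne y + (φ : ℂ) • (1 : Matrix (Finset (Orb Λ)) (Finset (Orb Λ)) ℂ) ∈
      carEvenSubalgebra (orbSet W) :=
    Subalgebra.add_mem _ (Subalgebra.sub_mem _ (gammaOne_mem hx) (gammaOne_mem hy))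
      (Subalgebra.smul_mem _ (Subalgebra.one_mem _) _)
  have hB : gammaTwo x - gammaTwo y ∈ carEvenSubalgebra (orbSet W) :=
    Subalgebra.sub_mem _ (gammaTwo_mem hx) (gammaTwo_mem hy)
  exact Subalgebra.smul_mem _ (Subalgebra.add_mem _ (Subalgebra.mul_mem _ hA hA) (Subalgebra.mul_mem _ hB hB)) _

/-- The Coulomb bond is even and localised on any site set containing both ends. [cite: Koma2022, (8.1)] -/
theorem coulombBond_mem {W : Finset Λ} {x y : Λ} (hx : x ∈ W) (hy : y ∈ W) (g' : ℝ) :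
    (coulombBond g' x y : Matrix (Finset (Orb Λ)) (Finset (Orb Λ)) ℂ) ∈ carEvenSubalgebra (orbSet W) :=
  Subalgebra.smul_mem _ (Subalgebra.mul_mem _ (gammaThree_mem hx) (gammaThree_mem hy)) _

end Generic

end PairHopRP


/-! ### Ground states in matrix terms (general index type) -/

section GroundStates

variable {n : Type*} [Fintype n] [DecidableEq n]

omit [DecidableEq n] in
/-- `⟨toLp x, toLp y⟩ = x† y` (Euclidean inner product versus `dotProduct`). [cite: Tasaki2020, App. A.2] -/
theorem inner_toLp_toLp_eq_dotProduct (x y : n → ℂ) :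
    ⟪(toLp 2 x : EuclideanSpace ℂ n), toLp 2 y⟫_ℂ = star x ⬝ᵥ y := by
  rw [EuclideanSpace.inner_toLp_toLp, dotProduct_comm]

omit [DecidableEq n] in
/-- `‖toLp v‖² = Re v†v`. [cite: Tasaki2020, App. A.2] -/
theorem norm_toLp_sq_eq_re_dotProduct (v : n → ℂ) :
    ‖(toLp 2 v : EuclideanSpace ℂ n)‖ ^ 2 = (star v ⬝ᵥ v).re := by
  rw [← inner_toLp_toLp_eq_dotProduct, ← inner_self_eq_norm_sq (𝕜 := ℂ)]
  rfl

/-- **Ground states in matrix terms, I** (general index type): the ground-state energy of a Hermitian `K`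
bounds every unit Rayleigh quotient of `toEuclideanCLM K` — the hypothesis `hground` of the Koma–Tasaki field
theorems (variational principle; the torus version is `groundEnergy_le_re_inner_toEuclideanCLM` of
`DWaveKomaTasakiSystem.lean`). [cite: Tasaki2020, §2.1] -/
theorem _root_.Matrix.groundEnergy_le_re_inner_toEuclideanCLM' {K : Matrix n n ℂ} (hK : K.IsHermitian)
    (ψ : EuclideanSpace ℂ n) (hψ : ‖ψ‖ = 1) :
    K.groundEnergy ≤ (⟪ψ, toEuclideanCLM (n := n) (𝕜 := ℂ) K ψ⟫_ℂ).re := by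
  have hv : star (ofLp ψ) ⬝ᵥ ofLp ψ = 1 := by
    have h := inner_self_eq_norm_sq_to_K (𝕜 := ℂ) ψ
    rw [hψ] at h
    rw [← inner_toLp_toLp_eq_dotProduct, toLp_ofLp, h]
    norm_num
  have h := Matrix.groundEnergy_le_rayleigh_holds hK (ofLp ψ) hv
  have e : (⟪ψ, toEuclideanCLM (n := n) (𝕜 := ℂ) K ψ⟫_ℂ) = star (ofLp ψ) ⬝ᵥ (K *ᵥ ofLp ψ) := by
    rw [← inner_toLp_toLp_eq_dotProduct, ← toEuclideanCLM_toLp, toLp_ofLp]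
  rw [e]
  exact h

/-- **Ground states in matrix terms, II** (general index type): a unit eigenvector of the Hermitian `K` with
the ground-state energy minimises the Rayleigh quotient of `toEuclideanCLM K` — the hypothesis `hmin` of the
field theorems (with `K = H - B·O`). [cite: Tasaki2020, §2.1] -/
theorem _root_.Matrix.re_inner_toEuclideanCLM_le_of_groundState {K : Matrix n n ℂ} (hK : K.IsHermitian)
    {Φ : n → ℂ} (hΦ : star Φ ⬝ᵥ Φ = 1) (hKΦ : K *ᵥ Φ = ((K.groundEnergy : ℝ) : ℂ) • Φ)
    (ψ : EuclideanSpace ℂ n) (hψ : ‖ψ‖ = 1) :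
    (⟪(toLp 2 Φ : EuclideanSpace ℂ n), toEuclideanCLM (n := n) (𝕜 := ℂ) K (toLp 2 Φ)⟫_ℂ).re ≤
      (⟪ψ, toEuclideanCLM (n := n) (𝕜 := ℂ) K ψ⟫_ℂ).re := by
  have h1 : (⟪(toLp 2 Φ : EuclideanSpace ℂ n), toEuclideanCLM (n := n) (𝕜 := ℂ) K (toLp 2 Φ)⟫_ℂ).re =
      K.groundEnergy := by
    rw [toEuclideanCLM_toLp, hKΦ, toLp_smul, inner_smul_right, inner_toLp_toLp_eq_dotProduct, hΦ, mul_one,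
      Complex.ofReal_re]
  rw [h1]
  exact Matrix.groundEnergy_le_re_inner_toEuclideanCLM' hK ψ hψ

/-- A Hermitian matrix acts as a symmetric operator on `EuclideanSpace ℂ n`. [cite: Tasaki2020, App. A.2] -/
theorem isSymmetric_toEuclideanCLM_of_isHermitian {A : Matrix n n ℂ} (hA : A.IsHermitian) :
    ((toEuclideanCLM (n := n) (𝕜 := ℂ) A : EuclideanSpace ℂ n →L[ℂ] EuclideanSpace ℂ n) :
      EuclideanSpace ℂ n →ₗ[ℂ] EuclideanSpace ℂ n).IsSymmetric :=
  ContinuousLinearMap.isSelfAdjoint_iff_isSymmetric.mp ((Matrix.isSelfAdjoint_toEuclideanCLM_iff A).mpr hA)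

/-- Commuting matrices give commuting operators on `EuclideanSpace ℂ n`. [cite: Tasaki2020, App. A.2] -/
theorem commute_toEuclideanCLM_of_commute {A B : Matrix n n ℂ} (h : Commute A B) :
    Commute (toEuclideanCLM (n := n) (𝕜 := ℂ) A) (toEuclideanCLM (n := n) (𝕜 := ℂ) B) := by
  have := congrArg (toEuclideanCLM (n := n) (𝕜 := ℂ)) h.eq
  rw [map_mul, map_mul] at this
  exact this

end GroundStates

/-! ### Koma's model on the torus: local Hamiltonians, order densities, the instance -/

namespace KomaPiFlux

attribute [local instance] LiebCutRP.decEqTorus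

variable {d L : ℕ} [NeZero L]

namespace KT

/-- The Fock-space index type of the torus `(ℤ/Lℤ)^{d+1}`. [folklore] -/
abbrev Idx (d L : ℕ) : Type := Finset (Orb (FermionTorus (d + 1) L))

/-! #### The closed neighbourhood of a site -/

/-- The closed neighbourhood `{x} ∪ {y : y ∼ x}` of a site (the support set `S_x` of hypothesis ii)).
[cite: KomaTasaki1994, §2.3 ii)] -/
def nbhd (x : FermionTorus (d + 1) L) : Finset (FermionTorus (d + 1) L) :=
  insert x (Finset.univ.filter fun y => (G d L).Adj x y)

omit [NeZero L] in
/-- `x ∈ nbhd x`. [cite: KomaTasaki1994, §2.3 ii)] -/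
theorem self_mem_nbhd (x : FermionTorus (d + 1) L) : x ∈ nbhd x := Finset.mem_insert_self _ _

omit [NeZero L] in
/-- Neighbours lie in the closed neighbourhood. [cite: KomaTasaki1994, §2.3 ii)] -/
theorem mem_nbhd_of_adj {x y : FermionTorus (d + 1) L} (h : (G d L).Adj x y) : y ∈ nbhd x :=
  Finset.mem_insert_of_mem (Finset.mem_filter.2 ⟨Finset.mem_univ _, h⟩)

omit [NeZero L] in
/-- Outside the closed neighbourhood a site is disjoint from it. [cite: KomaTasaki1994, §2.3 ii)] -/
theorem disjoint_nbhd_singleton {x y : FermionTorus (d + 1) L} (hy : y ∉ nbhd x) : Disjoint (nbhd x) {y} :=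
  Finset.disjoint_singleton_right.2 hy

/-- `|nbhd x| ≤ 2(d+1) + 1`. [cite: KomaTasaki1994, §2.3 ii)] -/
theorem card_nbhd_le (x : FermionTorus (d + 1) L) : (nbhd x).card ≤ 2 * (d + 1) + 1 := by
  have h := card_filter_fermionTorusGraph_adj_le (d := d + 1) (L := L) x
  exact (Finset.card_insert_le _ _).trans (by unfold G at *; omega)

/-! #### The `π`-flux amplitudes are bounded -/

omit [NeZero L] in
/-- `|axialSign| = 1`. [cite: Koma2022, (2.8)] -/
theorem abs_axialSign (L c : ℕ) : |axialSign L c| = 1 := by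
  unfold axialSign; split_ifs <;> simp

omit [NeZero L] in
/-- `|bondSign x μ| = 1`. [cite: Koma2022, (2.8)–(2.9)] -/
theorem abs_bondSign (x : FermionTorus (d + 1) L) (μ : Fin (d + 1)) : |bondSign x μ| = 1 := by
  refine Fin.cases ?_ (fun i => ?_) μ
  · rw [bondSign_zero, abs_axialSign]
  · rw [bondSign_succ, transverseSign, abs_mul, abs_mul, abs_pow, abs_pow, abs_neg, abs_one, one_pow, one_pow,
      one_mul, one_mul, abs_axialSign]

/-- `|T_π(κ)(x, y)| ≤ 2(d+1)|κ|` (crude, uniform in the volume). [cite: Koma2022, (2.7)–(2.9)] -/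
theorem norm_piFluxAmpl_le (κ : ℝ) (σ : Fin 2) (x y : FermionTorus (d + 1) L) :
    ‖piFluxAmpl (d := d) (L := L) κ σ x y‖ ≤ 2 * (d + 1) * |κ| := by
  unfold piFluxAmpl
  rw [Complex.norm_real, Real.norm_eq_abs, abs_mul]
  have hsum : |∑ μ : Fin (d + 1), ((if y = shift x μ then bondSign x μ else 0) +
      (if x = shift y μ then bondSign y μ else 0))| ≤ ∑ _μ : Fin (d + 1), (2 : ℝ) := by
    refine (Finset.abs_sum_le_sum_abs _ _).trans (Finset.sum_le_sum fun μ _ => ?_)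
    refine (abs_add_le _ _).trans ?_
    have h1 : |(if y = shift x μ then bondSign x μ else 0)| ≤ 1 := by
      split_ifs
      · exact (abs_bondSign x μ).le
      · simp
    have h2 : |(if x = shift y μ then bondSign y μ else 0)| ≤ 1 := by
      split_ifs
      · exact (abs_bondSign y μ).le
      · simp
    linarith
  rw [Finset.sum_const, Finset.card_univ, Fintype.card_fin, nsmul_eq_mul] at hsum
  calc |κ| * _ ≤ |κ| * ((d + 1 : ℕ) * 2) := mul_le_mul_of_nonneg_left hsum (abs_nonneg κ)
    _ = 2 * (d + 1) * |κ| := by push_cast; ring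

/-! #### The local Hamiltonian anchored at a site -/

/-- The symmetrised hoppings on the bonds out of `x`:
`-½ Σ_{y ∼ x} Σ_σ [T_σ(x,y) c†_{xσ}c_{yσ} + T_σ(y,x) c†_{yσ}c_{xσ}]`. [cite: KomaTasaki1994, §3.3 (2.3)] [cite: Koma2022, (2.7)] -/
def localHop (κ : ℝ) (x : FermionTorus (d + 1) L) : Matrix (Idx d L) (Idx d L) ℂ :=
  -(((1 / 2 : ℝ) : ℂ) • ∑ y : FermionTorus (d + 1) L, ∑ σ : Fin 2,
    if (G d L).Adj x y then
      piFluxAmpl κ σ x y • (creation (orb x σ) * annihilation (orb y σ)) +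
        piFluxAmpl κ σ y x • (creation (orb y σ) * annihilation (orb x σ))
    else 0)

/-- The on-site term `U(n_{x↑}-½)(n_{x↓}-½)`. [cite: Koma2022, (2.4)] [cite: Lieb1994, eq. (2)] -/
def localU (U : ℝ) (x : FermionTorus (d + 1) L) : Matrix (Idx d L) (Idx d L) ℂ :=
  (U : ℂ) • ((numberOp x 0 - (1 / 2 : ℂ) • 1) * (numberOp x 1 - (1 / 2 : ℂ) • 1))

/-- The pair bonds out of `x` (zero DLS field): `Σ_{y ∼ x} (g/8){[Γ¹_x-Γ¹_y]²+[Γ²_x-Γ²_y]²}`. [cite: Koma2022, (3.5)] -/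
def localPairI (g : ℝ) (x : FermionTorus (d + 1) L) : Matrix (Idx d L) (Idx d L) ℂ :=
  ∑ y : FermionTorus (d + 1) L, if (G d L).Adj x y then bondTerm g 0 x y else 0

/-- The Coulomb bonds out of `x`: `Σ_{y ∼ x} (g'/2)Γ³_xΓ³_y`. [cite: Koma2022, (8.1)] -/
def localCoul (g' : ℝ) (x : FermionTorus (d + 1) L) : Matrix (Idx d L) (Idx d L) ℂ :=
  ∑ y : FermionTorus (d + 1) L, if (G d L).Adj x y then coulombBond g' x y else 0

/-- **The local Hamiltonian `h_x`** of Koma's model: the terms of `H(κ,U;g,g';0;0)` anchored at `x`.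
[cite: KomaTasaki1994, (2.3), §3.3] [cite: Koma2022, (2.4), (2.6)] -/
def localHam (κ U g g' : ℝ) (x : FermionTorus (d + 1) L) : Matrix (Idx d L) (Idx d L) ℂ :=
  localHop κ x + localU U x + localPairI g x + localCoul g' x

omit [NeZero L] in
/-- `if p then a + b else 0 = (if p then a else 0) + (if p then b else 0)`. [folklore] -/
private theorem ite_add_zero {M : Type*} [AddZeroClass M] (p : Prop) [Decidable p] (a b : M) :
    (if p then a + b else 0) = (if p then a else 0) + (if p then b else 0) := by
  split_ifs <;> simp

/-- The symmetrised local hoppings sum to the hopping part of `peierlsHubbard`. [cite: KomaTasaki1994, (2.3)] -/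
theorem sum_localHop (κ : ℝ) :
    ∑ x : FermionTorus (d + 1) L, localHop κ x =
      -(∑ x : FermionTorus (d + 1) L, ∑ y : FermionTorus (d + 1) L, ∑ σ : Fin 2,
        if (G d L).Adj x y then piFluxAmpl κ σ x y • (creation (orb x σ) * annihilation (orb y σ)) else 0) := by
  -- the reversed hoppings, summed over all sites, give the same operator
  have hB : (∑ x : FermionTorus (d + 1) L, ∑ y : FermionTorus (d + 1) L, ∑ σ : Fin 2,
      if (G d L).Adj x y then piFluxAmpl κ σ y x • (creation (orb y σ) * annihilation (orb x σ)) else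
        (0 : Matrix (Idx d L) (Idx d L) ℂ)) =
      ∑ x : FermionTorus (d + 1) L, ∑ y : FermionTorus (d + 1) L, ∑ σ : Fin 2,
        if (G d L).Adj x y then piFluxAmpl κ σ x y • (creation (orb x σ) * annihilation (orb y σ)) else 0 := by
    rw [Finset.sum_comm]
    refine Finset.sum_congr rfl fun y _ => Finset.sum_congr rfl fun x _ => Finset.sum_congr rfl fun σ _ => ?_
    simp only [(G d L).adj_comm]
  -- per-site splitting of the symmetrised term
  have hsplit : ∀ x : FermionTorus (d + 1) L, localHop κ x =
      -(((1 / 2 : ℝ) : ℂ) • ((∑ y : FermionTorus (d + 1) L, ∑ σ : Fin 2,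
          if (G d L).Adj x y then piFluxAmpl κ σ x y • (creation (orb x σ) * annihilation (orb y σ)) else 0) +
        (∑ y : FermionTorus (d + 1) L, ∑ σ : Fin 2,
          if (G d L).Adj x y then piFluxAmpl κ σ y x • (creation (orb y σ) * annihilation (orb x σ)) else 0))) := by
    intro x
    unfold localHop
    simp only [ite_add_zero, Finset.sum_add_distrib]
  simp only [hsplit]
  rw [Finset.sum_neg_distrib, ← Finset.smul_sum, Finset.sum_add_distrib, hB, ← two_smul ℂ, smul_smul]
  norm_num

omit [NeZero L] in
/-- `Σ_x localU x = U Σ_x (n_{x↑}-½)(n_{x↓}-½)`. [cite: Koma2022, (2.4)] -/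
theorem sum_localU (U : ℝ) :
    ∑ x : FermionTorus (d + 1) L, localU U x =
      (U : ℂ) • ∑ x : FermionTorus (d + 1) L, (numberOp x 0 - (1 / 2 : ℂ) • 1) * (numberOp x 1 - (1 / 2 : ℂ) • 1) := by
  unfold localU; rw [Finset.smul_sum]

omit [NeZero L] in
/-- `Σ_x localPairI x = H_pair(g, 0)`. [cite: Koma2022, (3.5)] -/
theorem sum_localPairI (g : ℝ) :
    ∑ x : FermionTorus (d + 1) L, localPairI g x = pairInteraction (G d L) g (fun _ _ => (0 : ℝ)) := by
  unfold localPairI pairInteraction; rfl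

omit [NeZero L] in
/-- `Σ_x localCoul x = H_repul(g')`. [cite: Koma2022, (8.1)] -/
theorem sum_localCoul (g' : ℝ) :
    ∑ x : FermionTorus (d + 1) L, localCoul g' x = coulomb (G d L) g' := by
  unfold localCoul coulomb; rfl

/-- **`Σ_x h_x = H(κ,U;g,g';0;0)`** (no DLS field, no source). [cite: KomaTasaki1994, (2.3)] [cite: Koma2022, (2.4), (8.3)] -/
theorem sum_localHam (κ U g g' : ℝ) :
    ∑ x : FermionTorus (d + 1) L, localHam κ U g g' x =
      hamiltonianC κ U g g' (fun (_ _ : FermionTorus (d + 1) L) => (0 : ℝ)) 0 := by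
  unfold localHam
  rw [Finset.sum_add_distrib, Finset.sum_add_distrib, Finset.sum_add_distrib, sum_localHop, sum_localU,
    sum_localPairI, sum_localCoul, KomaPiFlux.hamiltonianC, PairHopRP.hamiltonianC, PairHopRP.hamiltonian,
    peierlsHubbard, Complex.ofReal_zero, zero_smul, sub_zero]

omit [NeZero L] in
/-- `(c†_p c_q)† = c†_q c_p`. [folklore] -/
private theorem hop_conjTranspose (p q : Orb (FermionTorus (d + 1) L)) :
    (creation p * annihilation q : Matrix (Idx d L) (Idx d L) ℂ)ᴴ = creation q * annihilation p := by
  rw [conjTranspose_mul, creation_conjTranspose, annihilation_conjTranspose]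

/-- The symmetrised local hopping is Hermitian (`T_σ(y,x) = T_σ(x,y)^*`). [cite: KomaTasaki1994, §2.1] [cite: Koma2022, (2.7)] -/
theorem isHermitian_localHop (κ : ℝ) (x : FermionTorus (d + 1) L) : (localHop κ x).IsHermitian := by
  unfold localHop
  have hc : star (((1 / 2 : ℝ) : ℂ)) = ((1 / 2 : ℝ) : ℂ) := by
    rw [Complex.star_def, Complex.conj_ofReal]
  rw [IsHermitian, conjTranspose_neg, conjTranspose_smul, hc, conjTranspose_sum]
  congr 2
  refine Finset.sum_congr rfl fun y _ => ?_
  rw [conjTranspose_sum]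
  refine Finset.sum_congr rfl fun σ _ => ?_
  split_ifs
  · rw [conjTranspose_add, conjTranspose_smul, conjTranspose_smul, hop_conjTranspose, hop_conjTranspose,
      ← piFluxAmpl_herm κ σ x y, ← piFluxAmpl_herm κ σ y x, add_comm]
  · rw [conjTranspose_zero]

omit [NeZero L] in
/-- The on-site term is Hermitian. [cite: Lieb1994, eq. (2)] -/
theorem isHermitian_localU (U : ℝ) (x : FermionTorus (d + 1) L) : (localU U x).IsHermitian := by
  unfold localU
  have hc : star ((U : ℂ)) = (U : ℂ) := by rw [Complex.star_def, Complex.conj_ofReal]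
  rw [IsHermitian, conjTranspose_smul, hc, conjTranspose_mul, numberOp_sub_half_conjTranspose,
    numberOp_sub_half_conjTranspose, ← numberOp_sub_half_comm]

omit [NeZero L] in
/-- The local pair interaction is Hermitian. [cite: Koma2022, (3.5)] -/
theorem isHermitian_localPairI (g : ℝ) (x : FermionTorus (d + 1) L) : (localPairI g x).IsHermitian :=
  isHermitian_finset_sum _ fun y _ => by
    by_cases h : (G d L).Adj x y
    · simp only [if_pos h]; exact bondTerm_isHermitian g 0 x y
    · simp only [if_neg h]; exact isHermitian_zero

omit [NeZero L] in
/-- The Coulomb bond is Hermitian (`Γ³_x`, `Γ³_y` are commuting Hermitian operators). [cite: Koma2022, (8.1)] -/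
theorem isHermitian_coulombBond (g' : ℝ) (x y : FermionTorus (d + 1) L) :
    (coulombBond g' x y : Matrix (Idx d L) (Idx d L) ℂ).IsHermitian := by
  have hc : star (((g' / 2 : ℝ) : ℂ)) = ((g' / 2 : ℝ) : ℂ) := by rw [Complex.star_def, Complex.conj_ofReal]
  rw [IsHermitian, coulombBond, conjTranspose_smul, hc, conjTranspose_gammaThree_mul]
  by_cases hxy : y = x
  · rw [hxy]
  · rw [(gammaThree_comm_gammaThree_of_ne' hxy)]
where
  /-- `Γ³_yΓ³_x = Γ³_xΓ³_y`. [folklore] -/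
  gammaThree_comm_gammaThree_of_ne' {x y : FermionTorus (d + 1) L} (_h : y ≠ x) :
      (gammaThree y * gammaThree x : Matrix (Idx d L) (Idx d L) ℂ) = gammaThree x * gammaThree y := by
    have h0 : ∀ (a b : FermionTorus (d + 1) L) (σ τ : Fin 2),
        Commute (numberOp a σ : Matrix (Idx d L) (Idx d L) ℂ) (numberOp b τ) := fun a b σ τ =>
      numberAt_commute (orb a σ) (orb b τ)
    have hc : Commute (gammaThree y : Matrix (Idx d L) (Idx d L) ℂ) (gammaThree x) := by
      unfold gammaThree
      refine Commute.sub_left (Commute.sub_left (Commute.one_left _) ?_) ?_ <;>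
        refine Commute.sub_right (Commute.sub_right (Commute.one_right _) (h0 _ _ _ _)) (h0 _ _ _ _)
    exact hc.eq

omit [NeZero L] in
/-- The local Coulomb term is Hermitian. [cite: Koma2022, (8.1)] -/
theorem isHermitian_localCoul (g' : ℝ) (x : FermionTorus (d + 1) L) : (localCoul g' x).IsHermitian :=
  isHermitian_finset_sum _ fun y _ => by
    by_cases h : (G d L).Adj x y
    · simp only [if_pos h]; exact isHermitian_coulombBond g' x y
    · simp only [if_neg h]; exact isHermitian_zero

/-- `h_x` is Hermitian. [cite: KomaTasaki1994, §2.1] -/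
theorem isHermitian_localHam (κ U g g' : ℝ) (x : FermionTorus (d + 1) L) : (localHam κ U g g' x).IsHermitian :=
  (((isHermitian_localHop κ x).add (isHermitian_localU U x)).add (isHermitian_localPairI g x)).add
    (isHermitian_localCoul g' x)

/-- `h_x` is an even operator localised on the closed neighbourhood of `x`. [cite: KomaTasaki1994, §2.3 ii)] -/
theorem localHam_mem (κ U g g' : ℝ) (x : FermionTorus (d + 1) L) :
    localHam κ U g g' x ∈ carEvenSubalgebra (orbSet (nbhd x)) := by
  have hx := self_mem_nbhd (d := d) (L := L) x
  unfold localHam localHop localU localPairI localCoul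
  refine Subalgebra.add_mem _ (Subalgebra.add_mem _ (Subalgebra.add_mem _ ?_ ?_) ?_) ?_
  · refine Subalgebra.neg_mem _ (Subalgebra.smul_mem _ (Subalgebra.sum_mem _ fun y _ =>
      Subalgebra.sum_mem _ fun σ _ => ?_) _)
    by_cases h : (G d L).Adj x y
    · rw [if_pos h]
      have hy := mem_nbhd_of_adj h
      exact Subalgebra.add_mem _
        (Subalgebra.smul_mem _ (creation_mul_annihilation_mem_carEvenSubalgebra (orb_mem_orbSet hx σ)
          (orb_mem_orbSet hy σ)) _)
        (Subalgebra.smul_mem _ (creation_mul_annihilation_mem_carEvenSubalgebra (orb_mem_orbSet hy σ)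
          (orb_mem_orbSet hx σ)) _)
    · rw [if_neg h]; exact Subalgebra.zero_mem _
  · have hn : ∀ σ : Fin 2, (numberOp x σ : Matrix (Idx d L) (Idx d L) ℂ) - (1 / 2 : ℂ) • 1 ∈
        carEvenSubalgebra (orbSet (nbhd x)) := fun σ =>
      Subalgebra.sub_mem _ (creation_mul_annihilation_mem_carEvenSubalgebra (orb_mem_orbSet hx σ)
        (orb_mem_orbSet hx σ)) (Subalgebra.smul_mem _ (Subalgebra.one_mem _) _)
    exact Subalgebra.smul_mem _ (Subalgebra.mul_mem _ (hn 0) (hn 1)) _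
  · refine Subalgebra.sum_mem _ fun y _ => ?_
    by_cases h : (G d L).Adj x y
    · rw [if_pos h]; exact bondTerm_mem hx (mem_nbhd_of_adj h) g 0
    · rw [if_neg h]; exact Subalgebra.zero_mem _
  · refine Subalgebra.sum_mem _ fun y _ => ?_
    by_cases h : (G d L).Adj x y
    · rw [if_pos h]; exact coulombBond_mem hx (mem_nbhd_of_adj h) g'
    · rw [if_neg h]; exact Subalgebra.zero_mem _

/-- The `L`-uniform norm bound `h̄ = 8(d+1)²|κ| + (9/4)|U| + 8(d+1)|g| + 9(d+1)|g'|`. [cite: KomaTasaki1994, §2.3 iii)] -/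
def hbarConst (d : ℕ) (κ U g g' : ℝ) : ℝ :=
  8 * (d + 1) ^ 2 * |κ| + 9 / 4 * |U| + 8 * (d + 1) * |g| + 9 * (d + 1) * |g'|

/-- A sum over the neighbours of `x` of terms of norm `≤ c` has norm `≤ 2(d+1)c`. [folklore] -/
private theorem norm_sum_adj_le {c : ℝ} (hc : 0 ≤ c) (x : FermionTorus (d + 1) L)
    (f : FermionTorus (d + 1) L → Matrix (Idx d L) (Idx d L) ℂ) (hf : ∀ y, (G d L).Adj x y → ‖f y‖ ≤ c) :
    ‖∑ y : FermionTorus (d + 1) L, (if (G d L).Adj x y then f y else 0)‖ ≤ 2 * (d + 1) * c := by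
  rw [← Finset.sum_filter]
  have hcard := card_filter_fermionTorusGraph_adj_le (d := d + 1) (L := L) x
  calc ‖∑ y ∈ Finset.univ.filter (fun y => (G d L).Adj x y), f y‖
      ≤ ∑ y ∈ Finset.univ.filter (fun y => (G d L).Adj x y), ‖f y‖ := norm_sum_le _ _
    _ ≤ ∑ y ∈ Finset.univ.filter (fun y => (G d L).Adj x y), c :=
        Finset.sum_le_sum fun y hy => hf y (Finset.mem_filter.1 hy).2
    _ = (Finset.univ.filter (fun y => (G d L).Adj x y)).card * c := by rw [Finset.sum_const, nsmul_eq_mul]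
    _ ≤ (2 * (d + 1) : ℕ) * c := by
        refine mul_le_mul_of_nonneg_right ?_ hc
        exact_mod_cast hcard
    _ = 2 * (d + 1) * c := by push_cast; ring

/-- `‖localHop x‖ ≤ 8(d+1)²|κ|`. [cite: KomaTasaki1994, §2.3 iii)] -/
theorem norm_localHop_le (κ : ℝ) (x : FermionTorus (d + 1) L) : ‖localHop κ x‖ ≤ 8 * (d + 1) ^ 2 * |κ| := by
  unfold localHop
  have hhop : ∀ p q : Orb (FermionTorus (d + 1) L), ‖(creation p * annihilation q : Matrix (Idx d L) (Idx d L) ℂ)‖ ≤ 1 :=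
    fun p q => (norm_mul_le _ _).trans (mul_le_one₀ (norm_creation_le_one _) (norm_nonneg _) (norm_annihilation_le_one _))
  have hterm : ∀ y, (G d L).Adj x y → ‖∑ σ : Fin 2, (piFluxAmpl κ σ x y • (creation (orb x σ) * annihilation (orb y σ)) +
      piFluxAmpl κ σ y x • (creation (orb y σ) * annihilation (orb x σ)) : Matrix (Idx d L) (Idx d L) ℂ)‖ ≤
        2 * (2 * (2 * (d + 1) * |κ|)) := by
    intro y _
    refine (norm_sum_le _ _).trans ?_
    have h1 : ∀ σ : Fin 2, ‖(piFluxAmpl κ σ x y • (creation (orb x σ) * annihilation (orb y σ)) +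
        piFluxAmpl κ σ y x • (creation (orb y σ) * annihilation (orb x σ)) : Matrix (Idx d L) (Idx d L) ℂ)‖ ≤
          2 * (2 * (d + 1) * |κ|) := by
      intro σ
      refine (norm_add_le _ _).trans ?_
      rw [norm_smul, norm_smul]
      have ha := norm_piFluxAmpl_le (d := d) (L := L) κ σ x y
      have hb := norm_piFluxAmpl_le (d := d) (L := L) κ σ y x
      have hc := hhop (orb x σ) (orb y σ)
      have hd := hhop (orb y σ) (orb x σ)
      have h0 : 0 ≤ ‖piFluxAmpl (d := d) (L := L) κ σ x y‖ := norm_nonneg _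
      have h0' : 0 ≤ ‖piFluxAmpl (d := d) (L := L) κ σ y x‖ := norm_nonneg _
      nlinarith
    calc ∑ σ : Fin 2, ‖(piFluxAmpl κ σ x y • (creation (orb x σ) * annihilation (orb y σ)) +
        piFluxAmpl κ σ y x • (creation (orb y σ) * annihilation (orb x σ)) : Matrix (Idx d L) (Idx d L) ℂ)‖
        ≤ ∑ _σ : Fin 2, 2 * (2 * (d + 1) * |κ|) := Finset.sum_le_sum fun σ _ => h1 σ
      _ = 2 * (2 * (2 * (d + 1) * |κ|)) := by norm_num [Finset.sum_const]
  have hsplit : (∑ y : FermionTorus (d + 1) L, ∑ σ : Fin 2,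
      (if (G d L).Adj x y then
        piFluxAmpl κ σ x y • (creation (orb x σ) * annihilation (orb y σ)) +
          piFluxAmpl κ σ y x • (creation (orb y σ) * annihilation (orb x σ)) else (0 : Matrix (Idx d L) (Idx d L) ℂ))) =
      ∑ y : FermionTorus (d + 1) L, (if (G d L).Adj x y then ∑ σ : Fin 2,
        (piFluxAmpl κ σ x y • (creation (orb x σ) * annihilation (orb y σ)) +
          piFluxAmpl κ σ y x • (creation (orb y σ) * annihilation (orb x σ))) else 0) := by
    refine Finset.sum_congr rfl fun y _ => ?_
    split_ifs
    · rfl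
    · simp
  rw [norm_neg, norm_smul, Complex.norm_real, Real.norm_eq_abs, abs_of_pos (by norm_num : (0:ℝ) < 1 / 2), hsplit]
  have h := norm_sum_adj_le (by positivity) x _ hterm
  calc 1 / 2 * _ ≤ 1 / 2 * (2 * (d + 1) * (2 * (2 * (2 * (d + 1) * |κ|)))) := by gcongr
    _ = 8 * (d + 1) ^ 2 * |κ| := by ring

omit [NeZero L] in
/-- `‖localU x‖ ≤ (9/4)|U|`. [cite: KomaTasaki1994, §2.3 iii)] -/
theorem norm_localU_le (U : ℝ) (x : FermionTorus (d + 1) L) : ‖localU U x‖ ≤ 9 / 4 * |U| := by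
  unfold localU
  have hn : ∀ σ : Fin 2, ‖(numberOp x σ - (1 / 2 : ℂ) • 1 : Matrix (Idx d L) (Idx d L) ℂ)‖ ≤ 3 / 2 := by
    intro σ
    refine (norm_sub_le _ _).trans ?_
    rw [norm_smul, norm_one, mul_one]
    have h := norm_numberOp_le_one (Λ := FermionTorus (d + 1) L) x σ
    have h2 : ‖(1 / 2 : ℂ)‖ = 1 / 2 := by simp
    rw [h2]; linarith
  rw [norm_smul, Complex.norm_real, Real.norm_eq_abs]
  have h := norm_mul_le (numberOp x 0 - (1 / 2 : ℂ) • 1 : Matrix (Idx d L) (Idx d L) ℂ) (numberOp x 1 - (1 / 2 : ℂ) • 1)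
  have h94 : ‖((numberOp x 0 - (1 / 2 : ℂ) • 1) * (numberOp x 1 - (1 / 2 : ℂ) • 1) : Matrix (Idx d L) (Idx d L) ℂ)‖ ≤ 9 / 4 := by
    have := hn 0; have := hn 1
    nlinarith [norm_nonneg (numberOp x 0 - (1 / 2 : ℂ) • 1 : Matrix (Idx d L) (Idx d L) ℂ),
      norm_nonneg (numberOp x 1 - (1 / 2 : ℂ) • 1 : Matrix (Idx d L) (Idx d L) ℂ)]
  calc |U| * _ ≤ |U| * (9 / 4) := by gcongr
    _ = 9 / 4 * |U| := by ring

/-- `‖localPairI x‖ ≤ 8(d+1)|g|`. [cite: KomaTasaki1994, §2.3 iii)] -/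
theorem norm_localPairI_le (g : ℝ) (x : FermionTorus (d + 1) L) : ‖localPairI g x‖ ≤ 8 * (d + 1) * |g| := by
  unfold localPairI
  have h := norm_sum_adj_le (by positivity) x (fun y => bondTerm g 0 x y) fun y _ => norm_bondTerm_zero_le g x y
  calc _ ≤ 2 * (d + 1) * (4 * |g|) := h
    _ = 8 * (d + 1) * |g| := by ring

/-- `‖localCoul x‖ ≤ 9(d+1)|g'|`. [cite: KomaTasaki1994, §2.3 iii)] -/
theorem norm_localCoul_le (g' : ℝ) (x : FermionTorus (d + 1) L) : ‖localCoul g' x‖ ≤ 9 * (d + 1) * |g'| := by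
  unfold localCoul
  have h := norm_sum_adj_le (by positivity) x (fun y => coulombBond g' x y) fun y _ => norm_coulombBond_le g' x y
  calc _ ≤ 2 * (d + 1) * (9 / 2 * |g'|) := h
    _ = 9 * (d + 1) * |g'| := by ring

/-- **`‖h_x‖ ≤ h̄`**, uniformly in the volume. [cite: KomaTasaki1994, §2.3 iii)] -/
theorem norm_localHam_le (κ U g g' : ℝ) (x : FermionTorus (d + 1) L) :
    ‖localHam κ U g g' x‖ ≤ hbarConst d κ U g g' := by
  unfold localHam hbarConst
  refine (norm_add_le _ _).trans ?_
  refine (add_le_add ((norm_add_le _ _).trans (add_le_add ((norm_add_le _ _).trans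
    (add_le_add (norm_localHop_le κ x) (norm_localU_le U x))) (norm_localPairI_le g x))) (norm_localCoul_le g' x)).trans ?_
  exact le_of_eq (by ring)

/-! #### The order densities -/

/-- **The order densities**: `o^{(1)}_x = Γ²_x` (`α = 0`, so that `O^{(1)} = Σ_xΓ²_x` is the operator sourced by
`B` in `hamiltonianC κ U g g' 0 B`) and `o^{(2)}_x = Γ¹_x` (`α = 1`). [cite: Koma2022, (2.5), (3.3)] [cite: KomaTasaki1994, (2.13), §3.3] -/
def orderDensity (α : Fin 2) (x : FermionTorus (d + 1) L) : Matrix (Idx d L) (Idx d L) ℂ :=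
  if α = 0 then gammaTwo x else gammaOne x

omit [NeZero L] in
/-- `o^{(1)}_x = Γ²_x`. [cite: Koma2022, (3.3)] -/
@[simp] theorem orderDensity_zero (x : FermionTorus (d + 1) L) : orderDensity 0 x = gammaTwo x := if_pos rfl

omit [NeZero L] in
/-- `o^{(2)}_x = Γ¹_x`. [cite: Koma2022, (3.3)] -/
@[simp] theorem orderDensity_one (x : FermionTorus (d + 1) L) : orderDensity 1 x = gammaOne x := if_neg (by decide)

omit [NeZero L] in
/-- `Σ_x o^{(1)}_x = orderParameter` (`= Σ_xΓ²_x`). [cite: Koma2022, (2.5), (5.59)] -/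
theorem sum_orderDensity_zero :
    ∑ x : FermionTorus (d + 1) L, orderDensity 0 x = (orderParameter : Matrix (Idx d L) (Idx d L) ℂ) := by
  simp only [orderDensity_zero, orderParameter]

omit [NeZero L] in
/-- `Σ_x o^{(2)}_x = Σ_xΓ¹_x`. [cite: Koma2022, (3.3)] -/
theorem sum_orderDensity_one :
    ∑ x : FermionTorus (d + 1) L, orderDensity 1 x = (∑ x : FermionTorus (d + 1) L, gammaOne x : Matrix (Idx d L) (Idx d L) ℂ) := by
  simp only [orderDensity_one]

omit [NeZero L] in
/-- The order densities are Hermitian. [cite: Koma2022, (3.3)] -/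
theorem isHermitian_orderDensity (α : Fin 2) (x : FermionTorus (d + 1) L) : (orderDensity α x).IsHermitian := by
  unfold orderDensity; split_ifs
  · exact gammaTwo_isHermitian x
  · exact gammaOne_isHermitian x

omit [NeZero L] in
/-- The order densities are even and on-site. [cite: KomaTasaki1994, §2.3 i)] -/
theorem orderDensity_mem (α : Fin 2) {W : Finset (FermionTorus (d + 1) L)} {x : FermionTorus (d + 1) L} (hx : x ∈ W) :
    orderDensity α x ∈ carEvenSubalgebra (orbSet W) := by
  unfold orderDensity; split_ifs
  · exact gammaTwo_mem hx
  · exact gammaOne_mem hx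

omit [NeZero L] in
/-- `‖o^{(α)}_x‖ ≤ 2`. [cite: KomaTasaki1994, §2.3 iii)] -/
theorem norm_orderDensity_le (α : Fin 2) (x : FermionTorus (d + 1) L) : ‖orderDensity α x‖ ≤ 2 := by
  unfold orderDensity; split_ifs
  · exact norm_gammaTwo_le x
  · exact norm_gammaOne_le x

omit [NeZero L] in
/-- **(2.14), first relation**: `[Σ_xΓ²_x, N/2] = -iΣ_xΓ¹_x`. [cite: KomaTasaki1994, (2.14), §3.3] [cite: Koma2022, (3.8)–(3.10)] -/
theorem sum_orderDensity_zero_comm_halfNumber :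
    (∑ x : FermionTorus (d + 1) L, orderDensity 0 x) * ((2 : ℂ)⁻¹ • totalNumber) -
        ((2 : ℂ)⁻¹ • totalNumber) * (∑ x : FermionTorus (d + 1) L, orderDensity 0 x) =
      -(Complex.I • ∑ x : FermionTorus (d + 1) L, orderDensity 1 x) := by
  simp only [orderDensity_zero, orderDensity_one, Finset.sum_mul, Finset.mul_sum, ← Finset.sum_sub_distrib,
    gammaTwo_comm_halfNumber, Finset.sum_neg_distrib, Finset.smul_sum]

omit [NeZero L] in
/-- **(2.14), second relation**: `[Σ_xΓ¹_x, N/2] = iΣ_xΓ²_x`. [cite: KomaTasaki1994, (2.14), §3.3] [cite: Koma2022, (3.8)–(3.10)] -/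
theorem sum_orderDensity_one_comm_halfNumber :
    (∑ x : FermionTorus (d + 1) L, orderDensity 1 x) * ((2 : ℂ)⁻¹ • totalNumber) -
        ((2 : ℂ)⁻¹ • totalNumber) * (∑ x : FermionTorus (d + 1) L, orderDensity 1 x) =
      Complex.I • ∑ x : FermionTorus (d + 1) L, orderDensity 0 x := by
  simp only [orderDensity_zero, orderDensity_one, Finset.sum_mul, Finset.mul_sum, ← Finset.sum_sub_distrib,
    gammaOne_comm_halfNumber, Finset.smul_sum]

end KT

open KT

/-! #### The instance -/

/-- **Koma's `π`-flux BCS model (Lieb frame, torus `(ℤ/Lℤ)^{d+1}`) as a Koma–Tasaki `U(1)` system**: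
`h_x = localHam κ U g g' x`, `o^{(1)}_x = Γ²_x`, `o^{(2)}_x = Γ¹_x`, `C = N/2`, `S_x = nbhd x` (`r = 2(d+1)+1`),
`h̄ = hbarConst d κ U g g'`, `o = 2`, all transported along `Matrix.toEuclideanCLM`; hypotheses (2.12)–(2.16),
i)–iii) of KT94 §2.3 proved. [cite: KomaTasaki1994, §2.3 (2.12)–(2.17), §3.3–3.4] [cite: KomaTasaki1993, §7 (before Theorem 7.3)] [cite: Koma2022, (2.4)–(2.6), (3.3)] -/
def ktSystem (κ U g g' : ℝ) : KomaTasaki.U1System (FermionTorus (d + 1) L) (EuclideanSpace ℂ (Idx d L)) where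
  h x := toEuclideanCLM (n := Idx d L) (𝕜 := ℂ) (localHam κ U g g' x)
  o α x := toEuclideanCLM (n := Idx d L) (𝕜 := ℂ) (orderDensity α x)
  C := toEuclideanCLM (n := Idx d L) (𝕜 := ℂ) ((2 : ℂ)⁻¹ • totalNumber)
  supp := nbhd
  r := 2 * (d + 1) + 1
  hbar := hbarConst d κ U g g'
  obar := 2
  isSymmetric_h x := isSymmetric_toEuclideanCLM_of_isHermitian (isHermitian_localHam κ U g g' x)
  isSymmetric_o α x := isSymmetric_toEuclideanCLM_of_isHermitian (isHermitian_orderDensity α x)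
  isSymmetric_C := isSymmetric_toEuclideanCLM_of_isHermitian
    (IsHermitian.smul totalNumber_isHermitian (by rw [IsSelfAdjoint]; simp))
  commute_hamiltonian_C := by
    rw [← map_sum, sum_localHam]
    exact commute_toEuclideanCLM_of_commute
      ((PairHopRP.commute_totalNumber_hamiltonianC_zero (G d L) (piFluxAmpl κ) U g g').symm.smul_right _)
  order_zero_C := by
    rw [← map_sum, ← map_sum, ← map_mul, ← map_mul, ← map_sub, sum_orderDensity_zero_comm_halfNumber, map_neg,
      map_smul]
  order_one_C := by
    rw [← map_sum, ← map_sum, ← map_mul, ← map_mul, ← map_sub, sum_orderDensity_one_comm_halfNumber, map_smul]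
  commute_o x y hxy α β :=
    commute_toEuclideanCLM_of_commute (commute_of_mem_carEvenSubalgebra
      (orderDensity_mem α (Finset.mem_singleton_self x))
      ((carEvenSubalgebra_le_carSubalgebra _) (orderDensity_mem β (Finset.mem_singleton_self y)))
      (disjoint_orbSet (Finset.disjoint_singleton.2 hxy)))
  commute_h_o x y hy α :=
    commute_toEuclideanCLM_of_commute (commute_of_mem_carEvenSubalgebra (localHam_mem κ U g g' x)
      ((carEvenSubalgebra_le_carSubalgebra _) (orderDensity_mem α (Finset.mem_singleton_self y)))
      (disjoint_orbSet (disjoint_nbhd_singleton hy)))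
  card_supp_le := KT.card_nbhd_le
  two_le_r := by omega
  norm_h_le x := by rw [Matrix.l2_opNorm_toEuclideanCLM]; exact norm_localHam_le κ U g g' x
  norm_o_le α x := by rw [Matrix.l2_opNorm_toEuclideanCLM]; exact norm_orderDensity_le α x
  obar_pos := by norm_num

/-! #### Dictionary -/

section Dictionary

variable (κ U g g' : ℝ)

/-- `H_sys = toEuclideanCLM (H(κ,U;g,g';0;0))`. [cite: KomaTasaki1994, (2.3)] [cite: Koma2022, (2.4)] -/
theorem ktSystem_hamiltonian :
    (ktSystem (d := d) (L := L) κ U g g').hamiltonian =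
      toEuclideanCLM (n := Idx d L) (𝕜 := ℂ) (hamiltonianC κ U g g' (fun (_ _ : FermionTorus (d + 1) L) => (0 : ℝ)) 0) := by
  change ∑ x, toEuclideanCLM (n := Idx d L) (𝕜 := ℂ) (localHam κ U g g' x) = _
  rw [← map_sum, sum_localHam]

/-- `O^{(1)}_sys = toEuclideanCLM (Σ_xΓ²_x) = toEuclideanCLM orderParameter`. [cite: KomaTasaki1994, (2.13)] [cite: Koma2022, (2.5)] -/
theorem ktSystem_order_zero :
    (ktSystem (d := d) (L := L) κ U g g').order 0 = toEuclideanCLM (n := Idx d L) (𝕜 := ℂ) orderParameter := by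
  change ∑ x, toEuclideanCLM (n := Idx d L) (𝕜 := ℂ) (orderDensity 0 x) = _
  rw [← map_sum, sum_orderDensity_zero]

/-- `O^{(2)}_sys = toEuclideanCLM (Σ_xΓ¹_x)`. [cite: KomaTasaki1994, (2.13)] [cite: Koma2022, (3.3)] -/
theorem ktSystem_order_one :
    (ktSystem (d := d) (L := L) κ U g g').order 1 =
      toEuclideanCLM (n := Idx d L) (𝕜 := ℂ) (∑ x : FermionTorus (d + 1) L, gammaOne x) := by
  change ∑ x, toEuclideanCLM (n := Idx d L) (𝕜 := ℂ) (orderDensity 1 x) = _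
  rw [← map_sum, sum_orderDensity_one]

/-- `C_sys = toEuclideanCLM (N/2)`. [cite: KomaTasaki1994, (2.12), §3.3] -/
theorem ktSystem_C :
    (ktSystem (d := d) (L := L) κ U g g').C = toEuclideanCLM (n := Idx d L) (𝕜 := ℂ) ((2 : ℂ)⁻¹ • totalNumber) := rfl

/-- `o = 2`. [cite: KomaTasaki1994, §2.3 iii)] -/
theorem ktSystem_obar : (ktSystem (d := d) (L := L) κ U g g').obar = 2 := rfl

/-- `h̄ = hbarConst d κ U g g'`. [cite: KomaTasaki1994, §2.3 iii)] -/
theorem ktSystem_hbar : (ktSystem (d := d) (L := L) κ U g g').hbar = hbarConst d κ U g g' := rfl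

/-- `r = 2(d+1)+1`. [cite: KomaTasaki1994, §2.3 ii)] -/
theorem ktSystem_r : (ktSystem (d := d) (L := L) κ U g g').r = 2 * (d + 1) + 1 := rfl

/-- **The sourced Hamiltonian of the instance is Koma's sourced Hamiltonian**:
`H_sys - B·O^{(1)}_sys = toEuclideanCLM (hamiltonianC κ U g g' 0 B)` (`= H - B·Σ_xΓ²_x`).
[cite: Koma2022, (2.4), (3.6)] [cite: KomaTasaki1993, (2.6)] -/
theorem ktSystem_field (B : ℝ) :
    (ktSystem (d := d) (L := L) κ U g g').hamiltonian - (B : ℂ) • (ktSystem (d := d) (L := L) κ U g g').order 0 =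
      toEuclideanCLM (n := Idx d L) (𝕜 := ℂ) (hamiltonianC κ U g g' (fun (_ _ : FermionTorus (d + 1) L) => (0 : ℝ)) B) := by
  rw [ktSystem_hamiltonian, ktSystem_order_zero, ← map_smul, ← map_sub]
  congr 1
  rw [KomaPiFlux.hamiltonianC, KomaPiFlux.hamiltonianC, PairHopRP.hamiltonianC, PairHopRP.hamiltonianC,
    PairHopRP.hamiltonian, PairHopRP.hamiltonian, Complex.ofReal_zero, zero_smul, sub_zero]
  abel

/-- `hamiltonianC κ U g g' 0 B = hamiltonianC κ U g g' 0 0 - B·orderParameter` (the source term made explicit).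
[cite: Koma2022, (2.4), (3.6)] -/
theorem hamiltonianC_source (B : ℝ) :
    hamiltonianC κ U g g' (fun (_ _ : FermionTorus (d + 1) L) => (0 : ℝ)) B =
      hamiltonianC κ U g g' (fun (_ _ : FermionTorus (d + 1) L) => (0 : ℝ)) 0 - (B : ℂ) • orderParameter := by
  rw [KomaPiFlux.hamiltonianC, KomaPiFlux.hamiltonianC, PairHopRP.hamiltonianC, PairHopRP.hamiltonianC,
    PairHopRP.hamiltonian, PairHopRP.hamiltonian, Complex.ofReal_zero, zero_smul, sub_zero]
  abel

/-- `|Λ| = L^{d+1}` for the torus `(ℤ/Lℤ)^{d+1}`. [cite: Koma2022, (2.1)] -/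
theorem card_fermionTorus : Fintype.card (FermionTorus (d + 1) L) = L ^ (d + 1) := by
  rw [Fintype.card_congr FermionTorus.equivTorusSite]
  simp [TorusSite, ZMod.card]

/-- **Hypothesis iv) (2.17) for Koma's model from matrix data.** A unit Fock vector `Φ`, eigenvector of
`H = hamiltonianC κ U g g' 0 0` (eigenvalue `E₀`) and of the particle number (`NΦ = νΦ`), carrying
`η`-pairing long-range order `(2μ'|Λ|)² ≤ Re Φ†(Σ_xΓ¹_x)²Φ`, `0 < μ' ≤ 1`, is an `IsLROEigenstate` of `ktSystem`
with parameter `μ'`: the value for `O^{(1)} = Σ_xΓ²_x` equals that for `O^{(2)} = Σ_xΓ¹_x` by charge bookkeeping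
(`KomaTasaki.U1System.inner_order_sq_eq_of_eigen_C`). [cite: KomaTasaki1994, §2.3 iv) (2.17), §3.3] -/
theorem ktSystem_isLROEigenstate {Φ : Idx d L → ℂ} {E₀ : ℝ} {ν : ℂ} {μ' : ℝ}
    (hΦ : star Φ ⬝ᵥ Φ = 1)
    (hH : hamiltonianC κ U g g' (fun (_ _ : FermionTorus (d + 1) L) => (0 : ℝ)) 0 *ᵥ Φ = (E₀ : ℂ) • Φ)
    (hN : totalNumber *ᵥ Φ = ν • Φ) (hμ : 0 < μ') (hμ1 : μ' ≤ 1)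
    (hlro : (μ' * 2 * (Fintype.card (FermionTorus (d + 1) L) : ℝ)) ^ 2 ≤
      (star Φ ⬝ᵥ ((∑ x : FermionTorus (d + 1) L, gammaOne x) *ᵥ
        ((∑ x : FermionTorus (d + 1) L, gammaOne x) *ᵥ Φ))).re) :
    KomaTasaki.IsLROEigenstate (ktSystem (d := d) (L := L) κ U g g') (toLp 2 Φ) E₀ μ' := by
  set sys := ktSystem (d := d) (L := L) κ U g g' with hsys
  have hC : sys.C (toLp 2 Φ) = ((2 : ℂ)⁻¹ * ν) • toLp 2 Φ := by
    rw [hsys, ktSystem_C, toEuclideanCLM_toLp, smul_mulVec, hN, smul_smul, toLp_smul]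
  have hsq := KomaTasaki.U1System.inner_order_sq_eq_of_eigen_C sys hC
  have h1 : (⟪(toLp 2 Φ : EuclideanSpace ℂ (Idx d L)), sys.order 1 (sys.order 1 (toLp 2 Φ))⟫_ℂ).re =
      (star Φ ⬝ᵥ ((∑ x : FermionTorus (d + 1) L, gammaOne x) *ᵥ
        ((∑ x : FermionTorus (d + 1) L, gammaOne x) *ᵥ Φ))).re := by
    rw [hsys, ktSystem_order_one, toEuclideanCLM_toLp, toEuclideanCLM_toLp, inner_toLp_toLp_eq_dotProduct]
  exact
    { norm_eq_one := norm_toLp_eq_one_of_dotProduct hΦ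
      eigen_hamiltonian := by rw [hsys, ktSystem_hamiltonian, toEuclideanCLM_toLp, hH, toLp_smul]
      eigen_C := ⟨_, hC⟩
      mu_pos := hμ
      mu_le_one := hμ1
      lro := by
        rw [hsq, h1, hsys, ktSystem_obar]
        simpa [mul_comm, mul_assoc, mul_left_comm] using hlro
      lro_eq := hsq }

end Dictionary

end KomaPiFlux

end Literature.MathematicalPhysics.QuantumLattice

end
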